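import Summits.Schanuel.Schanuel.Theorems.ZilberEacBranchPolarForm
import Summits.Schanuel.Schanuel.Theorems.ZilberEacBranchKernel
import Literature.ModelTheory.Zilber.EACMonomialChange
import HarnessLib

/-!
# The exponential-polynomial regime, CXXII: `GL₂(ℤ)`-TRANSPORT OF ROWS AND OF AN EQUAL-ORDER PLACE

HONEST FRAMING.  Cell `pub-schanuel` (Zilber's Exponential-Algebraic Closedness, case ladder;
host summit Schanuel), seat 2, gen 35.  Bookkeeping for the complete verdict over curves with an
equal-order place of non-real direction (O93).  For an inverse pair `U V = V U = 1` of integer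
matrices: (1) **`exists_rowsTransport`** — a ring automorphism `τ` of `ℂ[x₀][x₁]` with
`(τ G)(x') = G(V x')`; (2) **`exists_transportedPlace`** — an equal-order place `x₀ = s^{-k}`,
`x₁ = Φ(s)s^{-k}` of `F = 0` with `U₀₀ + U₀₁Φ(0) ≠ 0` is carried by `x' = U x` to a place of
the transported curve `F'` (`F'(x') = F(V x')`), renormalised (polar reparametrisation of file
LII) to `x₀' = σ^{-k}`, `x₁' = Φ'(σ)σ^{-k}` with `Φ'(0) = (U₁₀ + U₁₁Φ(0))/(U₀₀ + U₀₁Φ(0))`;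
(3) **`natDegree_pos_of_place`** — a nonzero `F'` with such a place has positive `x₁'`-degree.
[folklore]; nothing here is specific to Schanuel's conjecture (neither used nor implied);
Mantova–Masser's question (PLMS 2024 §1 p. 5) and EC(3,2) stay OPEN; EAC ⇏ SC.
-/

noncomputable section

open Filter Topology Polynomial Bornology
open Literature.ModelTheory.Zilber

set_option linter.dupNamespace false

namespace Summit.Schanuel.Schanuel.Theorems

section PlaceLatticeTransport

/-! ## Part A. Transport of rows -/

/-- **Transport of rows.**  For an inverse pair `U V = V U = 1` there is a ring automorphism `τ`
of `ℂ[x₀][x₁]` with `(τ G)(x') = G(V x')` for all `x'`. [folklore] -/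
theorem exists_rowsTransport {U V : Matrix (Fin 2) (Fin 2) ℤ} (hUV : U * V = 1) (hVU : V * U = 1) :
    ∃ τ : ℂ[X][X] ≃+* ℂ[X][X], ∀ (G : ℂ[X][X]) (x : Fin 2 → ℂ),
      ((τ G).map (Polynomial.evalRingHom (x 0))).eval (x 1) =
        (G.map (Polynomial.evalRingHom (intLinMap V x 0))).eval (intLinMap V x 1) := by
  classical
  obtain ⟨Φr, hΦr⟩ := exists_rowsEquiv
  refine ⟨(Φr.symm.trans (linSubstEquiv (K := ℂ) hVU hUV).toRingEquiv).trans Φr, fun G x => ?_⟩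
  have e : x = ![x 0, x 1] := by funext i; fin_cases i <;> rfl
  have e' : intLinMap V x = ![intLinMap V x 0, intLinMap V x 1] := by funext i; fin_cases i <;> rfl
  have key : ∀ q : MvPolynomial (Fin 2) ℂ,
      (linSubstEquiv (K := ℂ) hVU hUV).toRingEquiv q = linSubst V q := fun q => rfl
  rw [RingEquiv.trans_apply, RingEquiv.trans_apply, ← hΦr, key, ← e, eval_linSubst, e', hΦr,
    RingEquiv.apply_symm_apply]
  rfl

/-! ## Part B. Transport of an equal-order place -/

/-- **Transport of an equal-order place.**  `F' (x') = F(V x')` (`U V = V U = 1`); a place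
`x₀ = s^{-k}`, `x₁ = Φ(s)s^{-k}` of `F = 0` (`k ≥ 1`, `Φ` analytic) with
`U₀₀ + U₀₁Φ(0) ≠ 0`.  Then `F' = 0` has a place `x₀' = σ^{-k}`, `x₁' = Φ'(σ)σ^{-k}` with `Φ'`
analytic and `Φ'(0) = (U₁₀ + U₁₁Φ(0))/(U₀₀ + U₀₁Φ(0))`. [folklore] (new in this form) -/
theorem exists_transportedPlace (F : ℂ[X][X]) {k : ℕ} (hk : 1 ≤ k) {Φ : ℂ → ℂ}
    (hΦan : AnalyticAt ℂ Φ 0)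
    (hplace : ∀ᶠ s in 𝓝[≠] (0 : ℂ),
      (F.map (Polynomial.evalRingHom (s ^ k)⁻¹)).eval (Φ s * (s ^ k)⁻¹) = 0)
    {U V : Matrix (Fin 2) (Fin 2) ℤ} (hVU : V * U = 1)
    (hU : ((U 0 0 : ℤ) : ℂ) + ((U 0 1 : ℤ) : ℂ) * Φ 0 ≠ 0) (F' : ℂ[X][X])
    (hF' : ∀ x : Fin 2 → ℂ, (F'.map (Polynomial.evalRingHom (x 0))).eval (x 1) =
      (F.map (Polynomial.evalRingHom (intLinMap V x 0))).eval (intLinMap V x 1)) :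
    ∃ Φ' : ℂ → ℂ, AnalyticAt ℂ Φ' 0 ∧
      Φ' 0 = (((U 1 0 : ℤ) : ℂ) + ((U 1 1 : ℤ) : ℂ) * Φ 0) /
        (((U 0 0 : ℤ) : ℂ) + ((U 0 1 : ℤ) : ℂ) * Φ 0) ∧
      ∀ᶠ σ in 𝓝[≠] (0 : ℂ),
        (F'.map (Polynomial.evalRingHom (σ ^ k)⁻¹)).eval (Φ' σ * (σ ^ k)⁻¹) = 0 := by
  -- the new leading coefficient of `x₀'`
  set U₀ : ℂ → ℂ := fun s => ((U 0 0 : ℤ) : ℂ) + ((U 0 1 : ℤ) : ℂ) * Φ s with hU₀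
  set U₁ : ℂ → ℂ := fun s => ((U 1 0 : ℤ) : ℂ) + ((U 1 1 : ℤ) : ℂ) * Φ s with hU₁
  have hU₀an : AnalyticAt ℂ U₀ 0 := analyticAt_const.add (analyticAt_const.mul hΦan)
  have hU₁an : AnalyticAt ℂ U₁ 0 := analyticAt_const.add (analyticAt_const.mul hΦan)
  have hU₀0 : U₀ 0 ≠ 0 := hU
  obtain ⟨lam, W, hLan, hL0, -, -, -, hLev⟩ := exists_polar_reparam hU₀an hU₀0 hk
  -- `lam` tends to `0` within `≠ 0`
  have hLt : Tendsto lam (𝓝[≠] (0 : ℂ)) (𝓝[≠] 0) := by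
    refine tendsto_nhdsWithin_iff.2 ⟨?_, ?_⟩
    · have h := hLan.continuousAt.tendsto
      rw [hL0] at h
      exact h.mono_left nhdsWithin_le_nhds
    · filter_upwards [hLev] with σ hσ
      exact hσ.1
  have hU₀ne : ∀ᶠ s in 𝓝 (0 : ℂ), U₀ s ≠ 0 := hU₀an.continuousAt.eventually_ne hU₀0
  refine ⟨fun σ => U₁ (lam σ) / U₀ (lam σ), ?_, ?_, ?_⟩
  · exact (hU₁an.comp_of_eq hLan hL0).div (hU₀an.comp_of_eq hLan hL0) (by rw [hL0]; exact hU₀0)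
  · show U₁ (lam 0) / U₀ (lam 0) = _
    rw [hL0]
  · filter_upwards [hLev, hLt.eventually hplace, (hLt.mono_right nhdsWithin_le_nhds).eventually hU₀ne]
      with σ hσ hFs hU₀s
    obtain ⟨hL0σ, hpol⟩ := hσ
    -- the point `x' = (σ^{-k}, Φ'(σ)σ^{-k}) = U x(lam σ)`
    have h0 : (σ ^ k)⁻¹ = intLinMap U ![(lam σ ^ k)⁻¹, Φ (lam σ) * (lam σ ^ k)⁻¹] 0 := by
      rw [← hpol]
      simp only [intLinMap, Fin.sum_univ_two, Matrix.cons_val_zero, Matrix.cons_val_one, hU₀]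
      ring
    have h1 : U₁ (lam σ) / U₀ (lam σ) * (σ ^ k)⁻¹ =
        intLinMap U ![(lam σ ^ k)⁻¹, Φ (lam σ) * (lam σ ^ k)⁻¹] 1 := by
      rw [← hpol]
      have hU₁σ : U₁ (lam σ) = ((U 1 0 : ℤ) : ℂ) + ((U 1 1 : ℤ) : ℂ) * Φ (lam σ) := rfl
      simp only [intLinMap, Fin.sum_univ_two, Matrix.cons_val_zero, Matrix.cons_val_one, hU₁σ]
      field_simp
    have hx' : (![(σ ^ k)⁻¹, U₁ (lam σ) / U₀ (lam σ) * (σ ^ k)⁻¹] : Fin 2 → ℂ) =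
        intLinMap U ![(lam σ ^ k)⁻¹, Φ (lam σ) * (lam σ ^ k)⁻¹] := by
      funext i; fin_cases i
      · exact h0
      · exact h1
    have h := hF' ![(σ ^ k)⁻¹, U₁ (lam σ) / U₀ (lam σ) * (σ ^ k)⁻¹]
    simp only [Matrix.cons_val_zero, Matrix.cons_val_one] at h
    rw [h, hx', intLinMap_intLinMap_of_mul_eq_one hVU]
    simpa using hFs

/-! ## Part C. A curve with a place has positive `x₁`-degree -/

/-- A nonzero `F ∈ ℂ[x₀][x₁]` with a place `x₀ = s^{-k}`, `x₁ = Φ(s)s^{-M}` (`k ≥ 1`) has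
positive `x₁`-degree: otherwise `F = g(x₀)` with `g(s^{-k}) = 0` for all small `s ≠ 0`.
[folklore] -/
theorem natDegree_pos_of_place (F : ℂ[X][X]) (hF0 : F ≠ 0) {k : ℕ} (hk : 1 ≤ k) (M : ℕ)
    {Φ : ℂ → ℂ}
    (hplace : ∀ᶠ s in 𝓝[≠] (0 : ℂ),
      (F.map (Polynomial.evalRingHom (s ^ k)⁻¹)).eval (Φ s * (s ^ M)⁻¹) = 0) :
    1 ≤ F.natDegree := by
  by_contra hlt
  have h0 : F.natDegree = 0 := by omega
  have hFC : F = Polynomial.C (F.coeff 0) := Polynomial.eq_C_of_natDegree_eq_zero h0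
  set g : ℂ[X] := F.coeff 0 with hg
  have hg0 : g ≠ 0 := fun h => hF0 (by rw [hFC, h, map_zero])
  have hev : ∀ᶠ s in 𝓝[≠] (0 : ℂ), g.eval (s ^ k)⁻¹ = 0 := by
    filter_upwards [hplace] with s hs
    rwa [hFC, Polynomial.map_C, Polynomial.eval_C, Polynomial.coe_evalRingHom] at hs
  have hne : (𝓝[≠] (0 : ℂ)).NeBot := inferInstance
  by_cases hdeg : 0 < g.degree
  · -- `|g(s^{-k})| → ∞`
    have hz : Tendsto (fun s : ℂ => ‖(s ^ k)⁻¹‖) (𝓝[≠] 0) atTop := by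
      have h1 : Tendsto (fun s : ℂ => ‖s‖⁻¹) (𝓝[≠] 0) atTop :=
        (tendsto_norm_nhdsNE_zero (E := ℂ)).inv_tendsto_nhdsGT_zero
      refine ((tendsto_pow_atTop (by omega : k ≠ 0)).comp h1).congr fun s => ?_
      simp [norm_inv, norm_pow, inv_pow]
    have hlim := g.tendsto_norm_atTop hdeg hz
    have h2 : ∀ᶠ s in 𝓝[≠] (0 : ℂ), (1 : ℝ) ≤ ‖g.eval (s ^ k)⁻¹‖ := hlim.eventually_ge_atTop 1
    obtain ⟨s, hs1, hs2⟩ := (h2.and hev).exists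
    rw [hs2, norm_zero] at hs1
    exact absurd hs1 (by norm_num)
  · -- `g` is a nonzero constant
    push Not at hdeg
    have hgc : g = Polynomial.C (g.coeff 0) := Polynomial.eq_C_of_degree_le_zero hdeg
    have hc0 : g.coeff 0 ≠ 0 := fun h => hg0 (by rw [hgc, h, map_zero])
    obtain ⟨s, hs⟩ := hev.exists
    rw [hgc, Polynomial.eval_C] at hs
    exact hc0 hs

end PlaceLatticeTransport

end Summit.Schanuel.Schanuel.Theorems

end
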